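import Literature.AlgebraicGeometry.Motives.FiniteFlatCoverReductionMultiset
import Literature.AlgebraicGeometry.Morphisms.FiniteUnramifiedFibreReduced
import HarnessLib

/-!
# Reduction of the generic geometric fibre of a finite flat cover with UNRAMIFIED fibre over the point: the `hred` hypothesis discharged
# ([SerreTate1968] §1; [Liu2002] §10.1.3; [StacksProject] 00U3, 02G3, 04GG, 02M0)

Topic `Literature/AlgebraicGeometry/Motives`, namespace `Literature.AlgebraicGeometry.Motives.IntegralModel` (D1 currency).  THEOREMS only (no def,
no instance, no notation, no named fact, no `sorry`).  Cell `hodgecm-mathlib` (D-0151), FLOOR 0, programme F0P5a, crux item stmt-HodgeConjecture-24832 —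
sequel of ★ `Motives/FiniteFlatCoverReductionMultiset` ((S-γ2) FINAL) composing it with ★ p800642 (F0P5a-p05 (g2), row (β))
`Morphisms.isReduced_tensor_sections_pullback_of_formallyUnramified_fibre`: the hypothesis `hred : IsReduced (Ω ⊗_R B)` of the point counts
(`B = Γ(pullback π.left xt.left, ⊤)` the fibre algebra over the integral point `xt : Spec R → 𝒮`, `R ⊆ Ω = \overline{K_v}` the valuation ring) HOLDS as
soon as the fibre of `π.left` over the geometric generic point `Spec Ω → Spec R →(xt) 𝒮` is FORMALLY UNRAMIFIED (e.g. étale) — transported to ANY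
`Algebra R B` with `algebraMap = φ` (hypothesis `halg`) and to the valuation subring's own `Algebra R Ω` (both by `Algebra.algebra_ext`).

* `isReduced_tensor_sections_of_formallyUnramified_fibre` — unramified fibre over the geometric generic point ⇒ `IsReduced (Ω ⊗_R B)`;
* `card_fibre_eq_finrank_of_formallyUnramified_fibre` — `#{y ∈ T(Ω) : p y = x} = rank_R B`;
* `ncard_fibre_geomReductionMap_eq_finrank_corner_of_formallyUnramified_fibre` / `…_length_corner_…` — **#points of the generic geometric fibre over
  `x` reducing to `reductionPoint yκ` = rank ∕ length of the corner of `B` at `yκ`**, now with only scheme-theoretic hypotheses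
  (`IsFinite`, `Flat`, `FormallyUnramified` of the generic geometric fibre).

HC_CM is proved only modulo the 7 printed citations until rung 0 closes; this file is a generic leaf and changes no count.

## References
* [SerreTate1968] J.-P. Serre, J. Tate, *Good reduction of abelian varieties*, Ann. of Math. 88 (1968), §1 (reduction map on points of proper models).
* [Liu2002] Q. Liu, *Algebraic Geometry and Arithmetic Curves*, §10.1.3 (reduction of points).
* [StacksProject] The Stacks Project, Tags 00U3 (étale algebras over a field), 02G3 (unramified morphisms), 04GG (finite algebras over henselian
  local rings), 02M0 (length and rank).
-/

set_option autoImplicit false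

noncomputable section

open CategoryTheory CategoryTheory.Limits AlgebraicGeometry IsDedekindDomain IsDedekindDomain.HeightOneSpectrum
open scoped NumberField TensorProduct
open Literature.NumberTheory.EllipticCurves (genericFibre)
open Literature.NumberTheory.GaloisRepresentations (closureValuationSubring)
open Literature.NumberTheory.DiophantineGeometry

namespace Literature.AlgebraicGeometry.Motives

namespace IntegralModel

variable {K : Type} [Field K] [NumberField K] {v : HeightOneSpectrum (𝓞 K)} {X T : SchemeOver K}
  (𝒮 : IntegralModel (valuationSubringAtPrime K v) K X) (𝒯 : IntegralModel (valuationSubringAtPrime K v) K T) (π : 𝒯.total ⟶ 𝒮.total)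

/-! ### Discharging `hred`: an UNRAMIFIED (e.g. étale) fibre of `π.left` over the geometric generic point `Spec Ω → Spec R → 𝒮` of `xt`
makes the generic fibre algebra `Ω ⊗_R B` reduced (★ p800642 `Morphisms.isReduced_tensor_sections_pullback_of_formallyUnramified_fibre`, transported to
ANY `Algebra R B` with `algebraMap = φ` and to the valuation subring's own `Algebra R Ω`) -/

/-- **Unramified generic fibre over `x` ⇒ `hred`**: if the fibre of `π.left` over the geometric generic point `Spec Ω → Spec R →(xt) 𝒮` is formally
unramified (e.g. `Etale`), then `Ω ⊗_R Γ(pullback π.left xt.left, ⊤)` is reduced, for any algebra structure with structure map `φ` (★ p800642 +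
`Algebra.algebra_ext` transport of both algebra structures). [cite: StacksProject, Tag 00U3] [cite: StacksProject, Tag 02G3] -/
theorem isReduced_tensor_sections_of_formallyUnramified_fibre [IsFinite π.left]
    (xt : specValuationSubring (closureValuationSubring (v.adicCompletion K)) (toClosureValuationSubring v) ⟶ 𝒮.total)
    [FormallyUnramified (pullback.snd π.left (Spec.map (CommRingCat.ofHom (algebraMap ↥(closureValuationSubring (v.adicCompletion K)) (AlgebraicClosure (v.adicCompletion K)))) ≫ xt.left))]
    [Algebra ↥(closureValuationSubring (v.adicCompletion K)) ((pullback π.left xt.left).presheaf.obj (Opposite.op ⊤))]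
    (halg : algebraMap ↥(closureValuationSubring (v.adicCompletion K)) ((pullback π.left xt.left).presheaf.obj (Opposite.op ⊤)) = ((Scheme.ΓSpecIso (CommRingCat.of ↥(closureValuationSubring (v.adicCompletion K)))).inv ≫ (pullback.snd π.left xt.left).appTop).hom) :
    IsReduced (AlgebraicClosure (v.adicCompletion K) ⊗[↥(closureValuationSubring (v.adicCompletion K))] ((pullback π.left xt.left).presheaf.obj (Opposite.op ⊤))) := by
  have hinst : ‹Algebra ↥(closureValuationSubring (v.adicCompletion K)) ((pullback π.left xt.left).presheaf.obj (Opposite.op ⊤))› = ((Scheme.ΓSpecIso (CommRingCat.of ↥(closureValuationSubring (v.adicCompletion K)))).inv ≫ (pullback.snd π.left xt.left).appTop).hom.toAlgebra :=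
    Algebra.algebra_ext _ _ fun r => by rw [halg]; rfl
  subst hinst
  have hΩ : (CommRingCat.ofHom (algebraMap ↥(closureValuationSubring (v.adicCompletion K)) (AlgebraicClosure (v.adicCompletion K)))).hom.toAlgebra =
      (inferInstance : Algebra ↥(closureValuationSubring (v.adicCompletion K)) (AlgebraicClosure (v.adicCompletion K))) :=
    Algebra.algebra_ext _ _ fun r => rfl
  have key := Literature.AlgebraicGeometry.Morphisms.isReduced_tensor_sections_pullback_of_formallyUnramified_fibre π.left xt.left
    (CommRingCat.ofHom (algebraMap ↥(closureValuationSubring (v.adicCompletion K)) (AlgebraicClosure (v.adicCompletion K))))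
  rw [hΩ] at key
  exact key

variable [IsProper 𝒮.total.hom] [IsProper 𝒯.total.hom]

/-- **`#{y ∈ T(Ω) : p y = x} = rank_R B` for `π.left` finite flat with UNRAMIFIED fibre over the geometric generic point of `xt`** (`card_fibre_eq_finrank`
with `hred` discharged by `isReduced_tensor_sections_of_formallyUnramified_fibre`). [cite: Liu2002, §10.1.3] [cite: StacksProject, Tag 00U3] -/
theorem card_fibre_eq_finrank_of_formallyUnramified_fibre (p : T ⟶ X)
    (hπp : (genericFibre (valuationSubringAtPrime K v) K).map π ≫ 𝒮.genericIso'.hom = 𝒯.genericIso'.hom ≫ p) [IsFinite π.left] [Flat π.left]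
    (x : AlgPoints X (AlgebraicClosure (v.adicCompletion K)))
    (xt : specValuationSubring (closureValuationSubring (v.adicCompletion K)) (toClosureValuationSubring v) ⟶ 𝒮.total)
    (hxt : extendPoint (closureValuationSubring (v.adicCompletion K)) (toClosureValuationSubring v) 𝒮.total (𝒮.modelPointsEquiv.symm x) = xt)
    [FormallyUnramified (pullback.snd π.left (Spec.map (CommRingCat.ofHom (algebraMap ↥(closureValuationSubring (v.adicCompletion K)) (AlgebraicClosure (v.adicCompletion K)))) ≫ xt.left))]
    [Algebra ↥(closureValuationSubring (v.adicCompletion K)) ((pullback π.left xt.left).presheaf.obj (Opposite.op ⊤))]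
    (halg : algebraMap ↥(closureValuationSubring (v.adicCompletion K)) ((pullback π.left xt.left).presheaf.obj (Opposite.op ⊤)) = ((Scheme.ΓSpecIso (CommRingCat.of ↥(closureValuationSubring (v.adicCompletion K)))).inv ≫ (pullback.snd π.left xt.left).appTop).hom) :
    Nat.card {y : AlgPoints T (AlgebraicClosure (v.adicCompletion K)) // AlgPoints.map p y = x} = Module.finrank ↥(closureValuationSubring (v.adicCompletion K)) ((pullback π.left xt.left).presheaf.obj (Opposite.op ⊤)) := by
  haveI := isReduced_tensor_sections_of_formallyUnramified_fibre 𝒮 𝒯 π xt halg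
  exact card_fibre_eq_finrank 𝒮 𝒯 π p hπp x xt hxt halg

/-- **MAIN with `hred` discharged (rank form)**: for `π.left` finite flat with unramified fibre over the geometric generic point of `xt`, the number of
points of the generic geometric fibre over `x` reducing to `reductionPoint yκ` is `rank_R (B ⧸ (1 - e I_yκ))`.
[cite: SerreTate1968, §1] [cite: Liu2002, §10.1.3] [cite: StacksProject, Tag 04GG] -/
theorem ncard_fibre_geomReductionMap_eq_finrank_corner_of_formallyUnramified_fibre (p : T ⟶ X)
    (hπp : (genericFibre (valuationSubringAtPrime K v) K).map π ≫ 𝒮.genericIso'.hom = 𝒯.genericIso'.hom ≫ p) [IsFinite π.left] [Flat π.left]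
    (x : AlgPoints X (AlgebraicClosure (v.adicCompletion K)))
    (xt : specValuationSubring (closureValuationSubring (v.adicCompletion K)) (toClosureValuationSubring v) ⟶ 𝒮.total)
    (hxt : extendPoint (closureValuationSubring (v.adicCompletion K)) (toClosureValuationSubring v) 𝒮.total (𝒮.modelPointsEquiv.symm x) = xt)
    [FormallyUnramified (pullback.snd π.left (Spec.map (CommRingCat.ofHom (algebraMap ↥(closureValuationSubring (v.adicCompletion K)) (AlgebraicClosure (v.adicCompletion K)))) ≫ xt.left))]
    [Algebra ↥(closureValuationSubring (v.adicCompletion K)) ((pullback π.left xt.left).presheaf.obj (Opposite.op ⊤))]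
    (halg : algebraMap ↥(closureValuationSubring (v.adicCompletion K)) ((pullback π.left xt.left).presheaf.obj (Opposite.op ⊤)) = ((Scheme.ΓSpecIso (CommRingCat.of ↥(closureValuationSubring (v.adicCompletion K)))).inv ≫ (pullback.snd π.left xt.left).appTop).hom)
    [Fintype (MaximalSpectrum (((pullback π.left xt.left).presheaf.obj (Opposite.op ⊤)) ⧸ (IsLocalRing.maximalIdeal ↥(closureValuationSubring (v.adicCompletion K))).map (algebraMap ↥(closureValuationSubring (v.adicCompletion K)) ((pullback π.left xt.left).presheaf.obj (Opposite.op ⊤)))))]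
    (e : (MaximalSpectrum (((pullback π.left xt.left).presheaf.obj (Opposite.op ⊤)) ⧸ (IsLocalRing.maximalIdeal ↥(closureValuationSubring (v.adicCompletion K))).map (algebraMap ↥(closureValuationSubring (v.adicCompletion K)) ((pullback π.left xt.left).presheaf.obj (Opposite.op ⊤))))) → ((pullback π.left xt.left).presheaf.obj (Opposite.op ⊤))) (he : CompleteOrthogonalIdempotents e)
    (hsep1 : ∀ I, 1 - e I ∈ I.asIdeal.comap (Ideal.Quotient.mk _)) (hsep0 : ∀ I I', I ≠ I' → e I ∈ I'.asIdeal.comap (Ideal.Quotient.mk _))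
    (yκ : residueFieldPoints 𝒯.total)
    (hyκ : yκ ≫ π = specRingHomι (closureValuationSubring (v.adicCompletion K)) (toClosureValuationSubring v) (IsLocalRing.residue (closureValuationSubring (v.adicCompletion K))) ≫ xt)
    (I : (MaximalSpectrum (((pullback π.left xt.left).presheaf.obj (Opposite.op ⊤)) ⧸ (IsLocalRing.maximalIdeal ↥(closureValuationSubring (v.adicCompletion K))).map (algebraMap ↥(closureValuationSubring (v.adicCompletion K)) ((pullback π.left xt.left).presheaf.obj (Opposite.op ⊤)))))) (hI : RingHom.ker ((pullback.lift yκ.left (Spec.map (CommRingCat.ofHom (IsLocalRing.residue (closureValuationSubring (v.adicCompletion K))))) (left_comp_left_eq_of_comp_eq 𝒮 𝒯 π xt yκ hyκ)).appTop ≫ (Scheme.ΓSpecIso (CommRingCat.of (IsLocalRing.ResidueField ↥(closureValuationSubring (v.adicCompletion K))))).hom).hom = I.asIdeal.comap (Ideal.Quotient.mk _)) :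
    Set.ncard {y : AlgPoints T (AlgebraicClosure (v.adicCompletion K)) | AlgPoints.map p y = x ∧ 𝒯.geomReductionMap y = 𝒯.reductionPoint yκ} =
      Module.finrank ↥(closureValuationSubring (v.adicCompletion K)) (((pullback π.left xt.left).presheaf.obj (Opposite.op ⊤)) ⧸ Ideal.span {1 - e I}) := by
  haveI := isReduced_tensor_sections_of_formallyUnramified_fibre 𝒮 𝒯 π xt halg
  exact ncard_fibre_geomReductionMap_eq_finrank_corner 𝒮 𝒯 π p hπp x xt hxt halg e he hsep1 hsep0 yκ hyκ I hI

/-- **MAIN with `hred` discharged (length form)**: … `= length (B_I ⧸ 𝔪 B_I)`, the multiplicity of `reductionPoint yκ` in the special fibre.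
[cite: SerreTate1968, §1] [cite: Liu2002, §10.1.3] [cite: StacksProject, Tag 02M0] -/
theorem ncard_fibre_geomReductionMap_eq_length_corner_of_formallyUnramified_fibre (p : T ⟶ X)
    (hπp : (genericFibre (valuationSubringAtPrime K v) K).map π ≫ 𝒮.genericIso'.hom = 𝒯.genericIso'.hom ≫ p) [IsFinite π.left] [Flat π.left]
    (x : AlgPoints X (AlgebraicClosure (v.adicCompletion K)))
    (xt : specValuationSubring (closureValuationSubring (v.adicCompletion K)) (toClosureValuationSubring v) ⟶ 𝒮.total)
    (hxt : extendPoint (closureValuationSubring (v.adicCompletion K)) (toClosureValuationSubring v) 𝒮.total (𝒮.modelPointsEquiv.symm x) = xt)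
    [FormallyUnramified (pullback.snd π.left (Spec.map (CommRingCat.ofHom (algebraMap ↥(closureValuationSubring (v.adicCompletion K)) (AlgebraicClosure (v.adicCompletion K)))) ≫ xt.left))]
    [Algebra ↥(closureValuationSubring (v.adicCompletion K)) ((pullback π.left xt.left).presheaf.obj (Opposite.op ⊤))]
    (halg : algebraMap ↥(closureValuationSubring (v.adicCompletion K)) ((pullback π.left xt.left).presheaf.obj (Opposite.op ⊤)) = ((Scheme.ΓSpecIso (CommRingCat.of ↥(closureValuationSubring (v.adicCompletion K)))).inv ≫ (pullback.snd π.left xt.left).appTop).hom)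
    [Fintype (MaximalSpectrum (((pullback π.left xt.left).presheaf.obj (Opposite.op ⊤)) ⧸ (IsLocalRing.maximalIdeal ↥(closureValuationSubring (v.adicCompletion K))).map (algebraMap ↥(closureValuationSubring (v.adicCompletion K)) ((pullback π.left xt.left).presheaf.obj (Opposite.op ⊤)))))]
    (e : (MaximalSpectrum (((pullback π.left xt.left).presheaf.obj (Opposite.op ⊤)) ⧸ (IsLocalRing.maximalIdeal ↥(closureValuationSubring (v.adicCompletion K))).map (algebraMap ↥(closureValuationSubring (v.adicCompletion K)) ((pullback π.left xt.left).presheaf.obj (Opposite.op ⊤))))) → ((pullback π.left xt.left).presheaf.obj (Opposite.op ⊤))) (he : CompleteOrthogonalIdempotents e)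
    (hsep1 : ∀ I, 1 - e I ∈ I.asIdeal.comap (Ideal.Quotient.mk _)) (hsep0 : ∀ I I', I ≠ I' → e I ∈ I'.asIdeal.comap (Ideal.Quotient.mk _))
    (hloc : ∀ I, IsLocalRing (((pullback π.left xt.left).presheaf.obj (Opposite.op ⊤)) ⧸ Ideal.span {1 - e I}))
    (yκ : residueFieldPoints 𝒯.total)
    (hyκ : yκ ≫ π = specRingHomι (closureValuationSubring (v.adicCompletion K)) (toClosureValuationSubring v) (IsLocalRing.residue (closureValuationSubring (v.adicCompletion K))) ≫ xt)
    (I : (MaximalSpectrum (((pullback π.left xt.left).presheaf.obj (Opposite.op ⊤)) ⧸ (IsLocalRing.maximalIdeal ↥(closureValuationSubring (v.adicCompletion K))).map (algebraMap ↥(closureValuationSubring (v.adicCompletion K)) ((pullback π.left xt.left).presheaf.obj (Opposite.op ⊤)))))) (hI : RingHom.ker ((pullback.lift yκ.left (Spec.map (CommRingCat.ofHom (IsLocalRing.residue (closureValuationSubring (v.adicCompletion K))))) (left_comp_left_eq_of_comp_eq 𝒮 𝒯 π xt yκ hyκ)).appTop ≫ (Scheme.ΓSpecIso (CommRingCat.of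 (IsLocalRing.ResidueField ↥(closureValuationSubring (v.adicCompletion K))))).hom).hom = I.asIdeal.comap (Ideal.Quotient.mk _)) :
    (Set.ncard {y : AlgPoints T (AlgebraicClosure (v.adicCompletion K)) | AlgPoints.map p y = x ∧ 𝒯.geomReductionMap y = 𝒯.reductionPoint yκ} : ℕ∞) =
      Module.length (((pullback π.left xt.left).presheaf.obj (Opposite.op ⊤)) ⧸ Ideal.span {1 - e I})
        ((((pullback π.left xt.left).presheaf.obj (Opposite.op ⊤)) ⧸ Ideal.span {1 - e I}) ⧸ (IsLocalRing.maximalIdeal ↥(closureValuationSubring (v.adicCompletion K))).map (algebraMap ↥(closureValuationSubring (v.adicCompletion K)) (((pullback π.left xt.left).presheaf.obj (Opposite.op ⊤)) ⧸ Ideal.span {1 - e I}))) := by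
  haveI := isReduced_tensor_sections_of_formallyUnramified_fibre 𝒮 𝒯 π xt halg
  exact ncard_fibre_geomReductionMap_eq_length_corner 𝒮 𝒯 π p hπp x xt hxt halg e he hsep1 hsep0 hloc yκ hyκ I hI

end IntegralModel

end Literature.AlgebraicGeometry.Motives

end
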